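import Mathlib.Analysis.SpecialFunctions.Pow.Real
import Summits.Ventures.Crystal3D.Theorems.StickyWulffConstantPolycrystalWulffBoundAggCertRows
import Summits.Ventures.Crystal3D.Theorems.StickyWulffConstantPolycrystalWulffBoundBoxCert3

/-!
# `PolycrystalWulffBound`, line `PolyDensity`: the reflective certificate CHECKER for `AggCert27_8` (computable part)

Route `StickyWulffConstant` of the venture `Summits/Ventures/Crystal3D`, crux `PolycrystalWulffBound`
(item `stmt-Ventures-19482`), second prover lane (poly-p2, gen 7).  Kernel discharge of the computational hypothesis
CH-P3, part 2: the computable checker.  Integer cube roots from below (`icbrt`, only `icbrt m ^ 3 ≤ m` is used),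
rational lower bounds `pow23lb q ≤ q^{2/3}` and `qK k ≤ 3·K_k^{1/3}`; rational boxes with their eight corners,
the subset forms at rational points (`aggLQ`), the minorant rule (`QBox.minor`: keep a form if it is non-negative at
the corners, else drop its `t`-part — a minorant on the chamber), the leaf test `checkLeaf` (weights `y ≥ 0` on rows
`< 100`; the dual/concavity inequality `KMAX·max(1,γ') ≤ Σ y·(lower bounds)` at the eight corners, `γ'` absorbing
any dual infeasibility into `E` since every primal variable is at most `E`, resp. `E/1.73205`), the kd-tree
`CTree` with `checkTree`, and the root box `[0,17/20]×[0,1/2]×[0,1/3]`.  Soundness in `…AggCertCheckSoundA/B`,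
`…AggCertCheckTree`; the certificate and its `native_decide` evaluation in `…AggCertData` / `…AggCertHolds`.
WHAT THIS IS NOT: the certificate data or a proof of `AggCert27_8` by itself; F-C1 not moved.
-/

noncomputable section

namespace Summit.Ventures.Crystal3D.Theorems

open Finset
open Summit.Ventures.Crystal3D.Cruxes.PolycrystalWulffBound.PolyDensity (AggCert27_8)



/-! ### Integer cube roots -/

/-- Binary search for `⌊m^{1/3}⌋` (only the lower-bound property is proved and used). -/
def icbrtAux (m : ℕ) : ℕ → ℕ → ℕ → ℕ
  | 0, l, _ => l
  | fuel + 1, l, h =>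
    if h ≤ l + 1 then l
    else if ((l + h) / 2) ^ 3 ≤ m then icbrtAux m fuel ((l + h) / 2) h else icbrtAux m fuel l ((l + h) / 2)

/-- The invariant `lo³ ≤ m` is preserved. -/
theorem icbrtAux_pow_le (m : ℕ) : ∀ (fuel lo hi : ℕ), lo ^ 3 ≤ m → (icbrtAux m fuel lo hi) ^ 3 ≤ m := by
  intro fuel
  induction fuel with
  | zero => intro lo hi h; simpa [icbrtAux] using h
  | succ n ih =>
    intro lo hi h
    simp only [icbrtAux]
    split_ifs with h1 h2
    · exact h
    · exact ih _ _ h2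
    · exact ih _ _ h

/-- Integer cube root from below: `(icbrt m)³ ≤ m`. -/
def icbrt (m : ℕ) : ℕ := icbrtAux m 400 0 (m + 1)

/-- `(icbrt m)³ ≤ m`. -/
theorem icbrt_pow_le (m : ℕ) : (icbrt m) ^ 3 ≤ m := icbrtAux_pow_le m 400 0 (m + 1) (by simp)

/-- Denominator of the rational cube-root lower bounds. -/
def cbrtDen : ℕ := 10 ^ 7

/-- A rational lower bound of `q^{2/3}` (`0` for `q ≤ 0`). -/
def pow23lb (q : ℚ) : ℚ :=
  if q ≤ 0 then 0 else (icbrt ((q.num.natAbs ^ 2 * cbrtDen ^ 3) / q.den ^ 2) : ℚ) / cbrtDen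

/-- Soundness of `pow23lb`: for `0 ≤ q`, `pow23lb q ≤ q^{2/3}` in `ℝ`. -/
theorem pow23lb_le {q : ℚ} (hq : 0 ≤ q) : ((pow23lb q : ℚ) : ℝ) ≤ ((q : ℚ) : ℝ) ^ ((2 : ℝ) / 3) := by
  unfold pow23lb
  split_ifs with h0
  · push_cast; exact Real.rpow_nonneg (by exact_mod_cast hq) _
  · push Not at h0
    set m : ℕ := (q.num.natAbs ^ 2 * cbrtDen ^ 3) / q.den ^ 2 with hm
    set n : ℕ := icbrt m with hn
    have hn3 : (n : ℝ) ^ 3 ≤ (m : ℝ) := by exact_mod_cast icbrt_pow_le m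
    have hden : (0 : ℝ) < q.den := by exact_mod_cast q.den_pos
    have hD : (0 : ℝ) < cbrtDen := by unfold cbrtDen; norm_num
    -- m ≤ q² D³
    have hm_le : (m : ℝ) ≤ ((q : ℝ)) ^ 2 * (cbrtDen : ℝ) ^ 3 := by
      have h1 : (m : ℝ) ≤ ((q.num.natAbs ^ 2 * cbrtDen ^ 3 : ℕ) : ℝ) / ((q.den ^ 2 : ℕ) : ℝ) := by
        rw [hm]; exact Nat.cast_div_le
      have hq' : (q : ℝ) = (q.num : ℝ) / (q.den : ℝ) := by exact_mod_cast (Rat.num_div_den q).symm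
      have habs : ((q.num.natAbs : ℕ) : ℝ) = |(q.num : ℝ)| := by
        rw [Nat.cast_natAbs, Int.cast_abs]
      refine le_trans h1 (le_of_eq ?_)
      push_cast
      rw [habs, hq', div_pow, sq_abs]
      field_simp
    -- (n / D)^3 ≤ q^2
    have hq0 : (0 : ℝ) ≤ (q : ℝ) := by exact_mod_cast hq
    have hkey : ((n : ℝ) / cbrtDen) ^ 3 ≤ (q : ℝ) ^ 2 := by
      rw [div_pow, div_le_iff₀ (by positivity)]
      exact le_trans hn3 hm_le
    have hlhs : (0 : ℝ) ≤ (n : ℝ) / cbrtDen := by positivity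
    -- take cube roots
    have h3 : ((n : ℝ) / cbrtDen) = ((((n : ℝ) / cbrtDen) ^ 3) ^ ((1 : ℝ) / 3)) := by
      rw [← Real.rpow_natCast, ← Real.rpow_mul hlhs]; norm_num
    have h4 : ((q : ℝ) ^ 2) ^ ((1 : ℝ) / 3) = (q : ℝ) ^ ((2 : ℝ) / 3) := by
      rw [← Real.rpow_natCast, ← Real.rpow_mul hq0]; norm_num
    push_cast
    rw [h3, ← h4]
    exact Real.rpow_le_rpow (by positivity) hkey (by norm_num)

/-! ### Rational lower bounds of the row coefficients `3·K^{1/3}` -/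

/-- Rational lower bounds `qK k ≤ 3·(aggK k)^{1/3}`. -/
def qK : Fin 13 → ℚ
  | 0 => 9524405 / 1000000     -- 32
  | 1 => 9518051 / 1000000     -- 3992/125
  | 2 => 9502926 / 1000000     -- 3973/125
  | 3 => 9473335 / 1000000     -- 3936/125
  | 4 => 9424140 / 1000000     -- 31
  | 5 => 4835973 / 1000000     -- 4π/3
  | 6 => 9088024 / 1000000     -- 139/5
  | 7 => 9081044 / 1000000     -- 3467/125
  | 8 => 9064425 / 1000000     -- 3448/125
  | 9 => 9031885 / 1000000     -- 3411/125
  | 10 => 8977721 / 1000000    -- 134/5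
  | 11 => 8605151 / 1000000    -- 118/5
  | 12 => 8376078 / 1000000    -- 4353/200

/-- `q ≤ 3·K^{1/3}` from `q³ ≤ 27·K`. -/
theorem le_three_mul_cbrt {q K : ℝ} (hK : 0 ≤ K) (h : q ^ 3 ≤ 27 * K) :
    q ≤ 3 * K ^ ((1 : ℝ) / 3) := by
  have h27 : (27 : ℝ) * K = (3 * K ^ ((1 : ℝ) / 3)) ^ 3 := by
    rw [mul_pow, ← Real.rpow_natCast (K ^ ((1 : ℝ) / 3)), ← Real.rpow_mul hK]; norm_num
  rw [h27] at h
  exact le_of_pow_le_pow_left₀ (by norm_num) (by positivity) h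

/-- Soundness of the table `qK`. -/
theorem qK_le (k : Fin 13) : ((qK k : ℚ) : ℝ) ≤ 3 * aggK k ^ ((1 : ℝ) / 3) := by
  have hpi := Real.pi_gt_d6
  fin_cases k <;> simp only [qK, aggK] <;> push_cast <;>
    refine le_three_mul_cbrt (by positivity) ?_ <;> nlinarith [hpi, Real.pi_pos]

/-! ### Boxes, forms at rational points, the leaf test -/

/-- Rational evaluation of the subset forms (same texts as `aggL`). -/
def aggLQ (i : Fin 15) (x1 x2 x3 : ℚ) : ℚ :=
  match i with
  | 0 => x1
  | 1 => x2
  | 2 => x3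
  | 3 => (1 - x1 - x2 - x3)
  | 4 => x1 + x2
  | 5 => x1 + x3
  | 6 => x2 + x3
  | 7 => x1 + (1 - x1 - x2 - x3)
  | 8 => x2 + (1 - x1 - x2 - x3)
  | 9 => x3 + (1 - x1 - x2 - x3)
  | 10 => x1 + x2 + x3
  | 11 => x1 + x2 + (1 - x1 - x2 - x3)
  | 12 => x1 + x3 + (1 - x1 - x2 - x3)
  | 13 => x2 + x3 + (1 - x1 - x2 - x3)
  | 14 => x1 + x2 + x3 + (1 - x1 - x2 - x3)

/-- `aggLQ` casts to `aggL`. -/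
theorem aggLQ_cast (i : Fin 15) (a b c : ℚ) : ((aggLQ i a b c : ℚ) : ℝ) = aggL i a b c := by
  fin_cases i <;> simp only [aggLQ, aggL] <;> push_cast <;> ring

/-- Affine coefficients `(c₀, c₁, c₂, c₃)` of the forms: `aggL i x = c₀ + c₁x₁ + c₂x₂ + c₃x₃`. -/
def aggLcoef : Fin 15 → ℚ × ℚ × ℚ × ℚ
  | 0 => (0, 1, 0, 0)
  | 1 => (0, 0, 1, 0)
  | 2 => (0, 0, 0, 1)
  | 3 => (1, -1, -1, -1)
  | 4 => (0, 1, 1, 0)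
  | 5 => (0, 1, 0, 1)
  | 6 => (0, 0, 1, 1)
  | 7 => (1, 0, -1, -1)
  | 8 => (1, -1, 0, -1)
  | 9 => (1, -1, -1, 0)
  | 10 => (0, 1, 1, 1)
  | 11 => (1, 0, 0, -1)
  | 12 => (1, 0, -1, 0)
  | 13 => (1, -1, 0, 0)
  | 14 => (1, 0, 0, 0)

/-- The forms are affine with the tabulated coefficients. -/
theorem aggL_eq_affine (i : Fin 15) (x1 x2 x3 : ℝ) :
    aggL i x1 x2 x3 = ((aggLcoef i).1 : ℝ) + ((aggLcoef i).2.1 : ℝ) * x1 + ((aggLcoef i).2.2.1 : ℝ) * x2 +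
      ((aggLcoef i).2.2.2 : ℝ) * x3 := by
  fin_cases i <;> simp only [aggL, aggLcoef] <;> push_cast <;> ring

/-- The forms without their `t`-part (`none` if nothing is left); on the chamber the result is a minorant. -/
def aggLdrop : Fin 15 → Option (Fin 15)
  | 0 => some 0
  | 1 => some 1
  | 2 => some 2
  | 3 => none
  | 4 => some 4
  | 5 => some 5
  | 6 => some 6
  | 7 => some 0
  | 8 => some 1
  | 9 => some 2
  | 10 => some 10
  | 11 => some 4
  | 12 => some 5
  | 13 => some 6
  | 14 => some 10

/-- On the chamber every form is non-negative. -/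
theorem aggL_nonneg (i : Fin 15) {x1 x2 x3 : ℝ} (h1 : 0 ≤ x1) (h2 : 0 ≤ x2) (h3 : 0 ≤ x3)
    (ht : x1 + x2 + x3 ≤ 1) : 0 ≤ aggL i x1 x2 x3 := by
  fin_cases i <;> simp only [aggL] <;> linarith

/-- On the chamber, dropping the `t`-part gives a minorant. -/
theorem aggL_drop_le (i j : Fin 15) (hij : aggLdrop i = some j) {x1 x2 x3 : ℝ}
    (ht : x1 + x2 + x3 ≤ 1) : aggL j x1 x2 x3 ≤ aggL i x1 x2 x3 := by
  fin_cases i <;> simp only [aggLdrop, Option.some.injEq, reduceCtorEq] at hij <;> subst hij <;>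
    simp only [aggL] <;> linarith

/-- A rational box `[a₁,b₁]×[a₂,b₂]×[a₃,b₃]`. -/
structure QBox where
  a1 : ℚ
  b1 : ℚ
  a2 : ℚ
  b2 : ℚ
  a3 : ℚ
  b3 : ℚ

/-- Corner coordinates (binary order as in `trilinear_weights`). -/
def QBox.cx1 (B : QBox) : Fin 8 → ℚ := ![B.a1, B.a1, B.a1, B.a1, B.b1, B.b1, B.b1, B.b1]
/-- Corner coordinates, second axis. -/
def QBox.cx2 (B : QBox) : Fin 8 → ℚ := ![B.a2, B.a2, B.b2, B.b2, B.a2, B.a2, B.b2, B.b2]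
/-- Corner coordinates, third axis. -/
def QBox.cx3 (B : QBox) : Fin 8 → ℚ := ![B.a3, B.b3, B.a3, B.b3, B.a3, B.b3, B.a3, B.b3]

/-- A form is kept if it is non-negative at the eight corners of the box, else its `t`-part is dropped. -/
def QBox.minor (B : QBox) (f : Fin 15) : Option (Fin 15) :=
  if (List.finRange 8).all (fun i => 0 ≤ aggLQ f (B.cx1 i) (B.cx2 i) (B.cx3 i)) then some f else aggLdrop f

/-- The chosen form is non-negative at every corner (checked again, uniformly). -/
def QBox.cornersNonneg (B : QBox) (g : Fin 15) : Bool :=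
  (List.finRange 8).all (fun i => 0 ≤ aggLQ g (B.cx1 i) (B.cx2 i) (B.cx3 i))

/-- A rational `c_B ≥ 0` with `c_B³ · b₃ ≤ 1` (a lower approximation of `b₃^{-1/3}`; `0` if `b₃ ≤ 0`). -/
def QBox.cB (B : QBox) : ℚ :=
  if B.b3 ≤ 0 then 0 else
    if ((icbrt ((B.b3.den * cbrtDen ^ 3) / B.b3.num.natAbs) : ℚ) / cbrtDen) ^ 3 * B.b3 ≤ 1 then
      (icbrt ((B.b3.den * cbrtDen ^ 3) / B.b3.num.natAbs) : ℚ) / cbrtDen else 0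

/-- `0 ≤ c_B`. -/
theorem QBox.cB_nonneg (B : QBox) : 0 ≤ B.cB := by
  unfold QBox.cB
  split_ifs
  · exact le_rfl
  · exact div_nonneg (Nat.cast_nonneg _) (by unfold cbrtDen; norm_num)
  · exact le_rfl

/-- `c_B³ · b₃ ≤ 1`. -/
theorem QBox.cB_pow_mul_le (B : QBox) : B.cB ^ 3 * B.b3 ≤ 1 := by
  unfold QBox.cB
  split_ifs with h0 h1
  · simp
  · exact h1
  · simp

/-- The upper bound `47623/5000` of `κ`. -/
def KMAXQ : ℚ := 47623 / 5000

/-- One weighted row of a leaf certificate: row index, minorant variant for the `S`-rows (`true` = `t^{2/3}`,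
`false` = linear `c_B·t`), weight. -/
abbrev Term := ℕ × Bool × ℚ

/-- The minorant form used for a left-hand side in box `B` (`none` = the term is dropped / not of power type). -/
def lhsForm (B : QBox) : AggLhs → Bool → Option (Fin 15)
  | .pow _ f, _ => B.minor f
  | .sum _, true => B.minor 3
  | .sum _, false => none
  | .recol, _ => none
  | .del f, _ => B.minor f
  | .zero, _ => none

/-- Rational lower bound, at corner `i`, of the `Φ + KMAX·Γ` contribution of one unit of a row. -/
def lhsLB (B : QBox) (l : AggLhs) (v : Bool) (i : Fin 8) : ℚ :=
  match l, v with
  | .pow k f, _ => match B.minor f with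
    | some g => qK k * pow23lb (aggLQ g (B.cx1 i) (B.cx2 i) (B.cx3 i))
    | none => 0
  | .sum k, true => match B.minor 3 with
    | some g => qK k * pow23lb (aggLQ g (B.cx1 i) (B.cx2 i) (B.cx3 i))
    | none => 0
  | .sum k, false => qK k * B.cB * aggLQ 3 (B.cx1 i) (B.cx2 i) (B.cx3 i)
  | .recol, _ => KMAXQ
  | .del f, _ => match B.minor f with
    | some g => KMAXQ * pow23lb (aggLQ g (B.cx1 i) (B.cx2 i) (B.cx3 i))
    | none => 0
  | .zero, _ => 0

/-- Sum over the certificate terms of `y ·` lower bounds at corner `i`. -/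
def termsLB (B : QBox) : List Term → Fin 8 → ℚ
  | [], _ => 0
  | (r, v, y) :: ts, i => y * lhsLB B (aggRow r).lhs v i + termsLB B ts i

/-- Aggregated right-hand coefficients `Σ y · c` of the certificate terms (sixteen rationals). -/
def termsRhs : List Term → AggRow
  | [] => ⟨.zero, 0, 0, 0, 0, 0, 0, 0, 0, 0, 0, 0, 0, 0, 0, 0, 0⟩
  | (r, _, y) :: ts =>
    let a := aggRow r
    let b := termsRhs ts
    ⟨.zero, y * a.cE + b.cE, y * a.cF1 + b.cF1, y * a.cF2 + b.cF2, y * a.cF3 + b.cF3, y * a.cFR + b.cFR,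
      y * a.cY1 + b.cY1, y * a.cY2 + b.cY2, y * a.cY3 + b.cY3, y * a.cYR + b.cYR, y * a.cA12 + b.cA12,
      y * a.cA13 + b.cA13, y * a.cA1R + b.cA1R, y * a.cA23 + b.cA23, y * a.cA2R + b.cA2R, y * a.cA3R + b.cA3R,
      y * a.cARR + b.cARR⟩

/-- The absorbed `E`-coefficient `γ' = c_E + Σ_{P ≠ E} k_P · max(0, c_P)` (`k_Y = 20000/34641`, else `1`). -/
def gammaOf (c : AggRow) : ℚ :=
  c.cE + max 0 c.cF1 + max 0 c.cF2 + max 0 c.cF3 + max 0 c.cFR +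
    (20000 / 34641) * (max 0 c.cY1 + max 0 c.cY2 + max 0 c.cY3 + max 0 c.cYR) +
    max 0 c.cA12 + max 0 c.cA13 + max 0 c.cA1R + max 0 c.cA23 + max 0 c.cA2R + max 0 c.cA3R + max 0 c.cARR

/-- All terms have non-negative weights, valid row indices, and their chosen forms are non-negative at the
corners. -/
def termsOK (B : QBox) : List Term → Bool
  | [] => true
  | (r, v, y) :: ts =>
    decide (r < 100) && decide (0 ≤ y) &&
      (match lhsForm B (aggRow r).lhs v with
        | some g => B.cornersNonneg g
        | none => true) &&
      termsOK B ts

/-- **The leaf test.** -/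
def checkLeaf (B : QBox) (ts : List Term) : Bool :=
  decide (B.a1 < B.b1) && decide (B.a2 < B.b2) && decide (B.a3 < B.b3) && decide (0 ≤ B.a1) && decide (0 ≤ B.a2) &&
    decide (0 ≤ B.a3) && termsOK B ts &&
    (List.finRange 8).all (fun i => decide (KMAXQ * max 1 (gammaOf (termsRhs ts)) ≤ termsLB B ts i))

/-! ### The certificate tree -/

/-- A kd-tree certificate: leaves carry weighted rows, `skip` marks a box outside the chamber, `split k`
bisects coordinate `k ∈ {0,1,2}` at the midpoint. -/
inductive CTree
  | leaf (ts : List Term)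
  | skip
  | split (k : ℕ) (l r : CTree)

/-- Lower half of a box along coordinate `k`. -/
def QBox.lowerHalf (B : QBox) (k : ℕ) : QBox :=
  match k with
  | 0 => { B with b1 := (B.a1 + B.b1) / 2 }
  | 1 => { B with b2 := (B.a2 + B.b2) / 2 }
  | _ => { B with b3 := (B.a3 + B.b3) / 2 }

/-- Upper half of a box along coordinate `k`. -/
def QBox.upperHalf (B : QBox) (k : ℕ) : QBox :=
  match k with
  | 0 => { B with a1 := (B.a1 + B.b1) / 2 }
  | 1 => { B with a2 := (B.a2 + B.b2) / 2 }
  | _ => { B with a3 := (B.a3 + B.b3) / 2 }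

/-- A sufficient exact test that the closed box misses the chamber
`{0 ≤ x₃ ≤ x₂ ≤ x₁ ≤ 17/20, x₁ + x₂ + x₃ ≤ 1}`. -/
def QBox.skipOK (B : QBox) : Bool :=
  decide (B.b1 < B.a2) || decide (B.b2 < B.a3) || decide (B.b1 < B.a3) ||
    decide (1 < max B.a1 (max B.a2 B.a3) + max B.a2 B.a3 + B.a3) || decide ((17 : ℚ) / 20 < max B.a1 (max B.a2 B.a3))

/-- **The tree checker.** -/
def checkTree : CTree → QBox → Bool
  | .leaf ts, B => checkLeaf B ts
  | .skip, B => B.skipOK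
  | .split k l r, B => checkTree l (B.lowerHalf k) && checkTree r (B.upperHalf k)

/-- The root box `[0, 17/20] × [0, 1/2] × [0, 1/3]` contains the chamber. -/
def rootBox : QBox := ⟨0, 17 / 20, 0, 1 / 2, 0, 1 / 3⟩


end Summit.Ventures.Crystal3D.Theorems

end
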